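import Summits.Ventures.LatticeQCDFlow.Exactness.Phi4HMCFluctuationRelation
import Mathlib.Analysis.SpecialFunctions.Trigonometric.DerivHyp
import Mathlib.Analysis.Calculus.Deriv.MeanValue
import HarnessLib

/-!
HONEST FRAMING: exact (Metropolis-corrected) sampling algorithms for lattice gauge theory; figures
of merit are autocorrelation/cost numbers at stated couplings and volumes; no continuum-physics
claim.

# AcceptanceFromMeanEnergyViolationSharp — THE EXTREMAL ACCEPTANCE OF A REVERSIBLE PROPOSAL GIVEN ITS
# MEAN ENERGY VIOLATION: `1 − ⟨P_acc⟩ ≤ (cosh a − 1 + ⟨ΔH⟩)/(a + sinh a)` FOR EVERY `a > 0`, WITH EQUALITY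
# FOR THE TWO-STATE FLIP OF GAP `a`; ENVELOPE `⟨P_acc⟩ ≥ 1 − tanh(a⋆/2) = 2/(1 + e^{a⋆})`,
# `a⋆ tanh(a⋆/2) = ⟨ΔH⟩` (row 22 `su3-ptbc`, GEN-10, ours; sequel of row 2's
# `AcceptanceFromMeanEnergyViolation` / `…Pinsker` and row 22's `PTBCSwapSignRule`)

Venture `LatticeQCDFlow` (cell pub-lqcd), topic `Exactness`; FANOUT row 22 (`su3-ptbc`, PTBC comparator arm
E4: per replica pair the swap log records give `⟨ΔS⟩` and the acceptance, both measured).  NEW WORK of the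
cell over row 2's framework `Exactness/Phi4HMCFluctuationRelation` (`(X, μ)`, `Ψ` a measurable `μ`-preserving
involution, weight `e^{−H}`, `ΔH = deltaH H Ψ = H∘Ψ − H`, the FLUCTUATION RELATION `∫ g(ΔH) e^{−H} =
∫ g(−ΔH) e^{−ΔH} e^{−H}`) and Mathlib (`monotoneOn_of_hasDerivWithinAt_nonneg`).  Nothing is cited as a fact.

THE POINT.  Row 2 typed two model-free floors of the equilibrium acceptance `A/Z`,
`A = ∫ min(1, e^{−ΔH}) e^{−H}`, `Z = ∫ e^{−H}`, in terms of the mean violation `m = ⟨ΔH⟩ = Z⁻¹∫ ΔH e^{−H}` alone: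
Bretagnolle–Huber `1 − √(1 − e^{−m})` (Creutz's identity suffices) and Pinsker `1 − √(m/2)` (uses the
involution).  Neither is sharp.  This file computes the EXACT worst case over all volume-preserving
reversible proposals: by the fluctuation relation the law of `ΔH` is determined by its restriction `ρ` to
`(0, ∞)`, with `1 − A/Z = ∫ (1 − e^{−x}) dρ`, `m = ∫ x(1 − e^{−x}) dρ` and `∫ (1 + e^{−x}) dρ ≤ 1`; the linear
programme "maximise the rejected mass at fixed `m`" is solved by ONE atom, and its dual certificate is the
elementary inequality of §1,
`(e^{x} − 1)(a + sinh a − x) ≤ (cosh a − 1)(e^{x} + 1)` for `x ≥ 0` (tangent at `x = a`).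
Integrating it against `e^{−H}` gives, for EVERY `a > 0`,

  `1 − A/Z ≤ (cosh a − 1 + m)/(a + sinh a)`,

a pencil of bounds affine in `m` whose lower envelope is `tanh(a⋆/2)` at `a⋆ tanh(a⋆/2) = m` — and the
two-state Metropolis flip with energy gap `a` (`ΔH = ±a`, acceptance `2/(1+e^{a})`, `m = a tanh(a/2)`) sits ON
every tangent, so nothing better can be said from `m` alone.  Members: `a = √(2m)` reproduces Pinsker's
`√(m/2)` (since `tanh(a/2) ≤ a/2`); `a = m` gives the stiff-regime floor `A/Z ≥ (1 − e^{−m})/(m + sinh m) ∼ 2e^{−m}`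
— four times the Bretagnolle–Huber floor `∼ ½e^{−m}` (sequel file).

## What is proved

* §1 (real analysis; the certificate `(cosh a − 1)(e^{x} + 1) − (e^{x} − 1)(a + sinh a − x)`):
  `hasDerivAt_sharpCert` (`∂ₓ = e^{x}(x − a + e^{−a}) − 1`), `sharpCert_self` (`= 0` at `x = a`),
  **`sharpCert_nonneg`** (`≥ 0` on `x ≥ 0`: decreasing on `[0, a]`, increasing on `[a, ∞)`);
  **`one_sub_min_exp_neg_mul_le`** — the integrand form, for every real `d`:
  `(1 − min(1, e^{−d}))(a + sinh a) ≤ (cosh a − 1)(1 + e^{−d})𝟙[d > 0] + d(1 − e^{−d})𝟙[d > 0]`.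
* §2 (`Ψ` a measurable `μ`-preserving involution, `e^{−H} ∈ L¹`, `ΔH e^{−H} ∈ L¹`, `Z > 0`):
  `integral_posPart_weights_le` (`∫ (1 + e^{−ΔH})𝟙[ΔH>0] e^{−H} ≤ Z`: it is `P(ΔH > 0) + P(ΔH < 0)`),
  `integral_posPart_moment_eq` (`∫ ΔH(1 − e^{−ΔH})𝟙[ΔH>0] e^{−H} = ∫ ΔH e^{−H}`), and the main theorem
  **`involutive_acceptance_ge_cosh`** — for every `a > 0`:
  `(1 − (cosh a − 1 + ⟨ΔH⟩)/(a + sinh a)) · Z ≤ ∫ min(1, e^{−ΔH}) e^{−H} dμ`.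
* Sequels (separate files): the stiff-regime members `a = ⟨ΔH⟩` (`A ≥ (1 − e^{−m})/(m + sinh m)·Z`,
  `A ≥ e^{−m}·Z` for `m ≥ 2`), the two-state attainment, and the HMC / replica-exchange swap instances.

Reading for CARD-su3-ptbc §3 / §14 (protocol, value-free): per replica pair the recorded `dS` series gives
`⟨dS⟩`; the pair's measured acceptance must lie above `1 − min_a (cosh a − 1 + ⟨dS⟩)/(a + sinh a)` up to
statistics — the tightest check available from `⟨dS⟩` alone, strictly above row 2's two floors at every
`⟨dS⟩ > 0`; the same holds for every HMC stream (`dH`).  Literature grade (cell rule): the fluctuation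
relation is KNOWN (Crooks 1999; for HMC Gupta–Irbäck–Karsch–Petersson 1990 discuss the law of `ΔH`); the
extremal statement and its certificate — presearch (corpus hybrid + vector + galaxy, 2026-08-25: Gubernatis–
Kawashima–Werner 2016 p. 308, Thijssen 2007 p. 361, Calvo–Sanz-Alonso–Sanz-Serna arXiv:1912.03253 §5) found
the Gaussian-model formula `erfc(½√⟨ΔH⟩)` and no distribution-free extremal bound — NEW TYPING, possibly new.
NOT CLAIMED: an upper bound on the acceptance from `⟨ΔH⟩` (none exists), the Gaussian model, any run number.
-/

namespace Summit.Ventures.LatticeQCDFlow.Exactness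

open Real MeasureTheory Filter Set

/-! ## §1 The dual certificate -/

section Certificate

/-- `∂ₓ [(cosh a − 1)(e^{x} + 1) − (e^{x} − 1)(a + sinh a − x)] = e^{x}(x − a + e^{−a}) − 1`
(uses `cosh a − sinh a = e^{−a}`). [ours] -/
theorem hasDerivAt_sharpCert (a x : ℝ) :
    HasDerivAt (fun x => (Real.cosh a - 1) * (Real.exp x + 1) - (Real.exp x - 1) * (a + Real.sinh a - x))
      (Real.exp x * (x - a + Real.exp (-a)) - 1) x := by
  have h1 : HasDerivAt (fun x => (Real.cosh a - 1) * (Real.exp x + 1))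
      ((Real.cosh a - 1) * Real.exp x) x :=
    ((Real.hasDerivAt_exp x).add_const 1).const_mul _
  have h2 : HasDerivAt (fun x => (Real.exp x - 1) * (a + Real.sinh a - x))
      (Real.exp x * (a + Real.sinh a - x) + (Real.exp x - 1) * (0 - 1)) x :=
    ((Real.hasDerivAt_exp x).sub_const 1).mul ((hasDerivAt_const x _).sub (hasDerivAt_id x))
  have h := h1.sub h2
  have hcs : Real.cosh a - Real.sinh a = Real.exp (-a) := Real.cosh_sub_sinh a
  refine h.congr_deriv ?_
  rw [← hcs]
  ring

/-- Tangency: the certificate vanishes at `x = a` (`e^{a} e^{−a} = 1`, i.e. `(cosh a − 1)(e^{a} + 1) =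
(e^{a} − 1) sinh a`). [ours] -/
theorem sharpCert_self (a : ℝ) :
    (Real.cosh a - 1) * (Real.exp a + 1) - (Real.exp a - 1) * (a + Real.sinh a - a) = 0 := by
  rw [Real.cosh_eq, Real.sinh_eq]
  have h : Real.exp a * Real.exp (-a) = 1 := by rw [← Real.exp_add, add_neg_cancel, Real.exp_zero]
  nlinarith [h]

/-- **THE CERTIFICATE**: for `x ≥ 0`, `(e^{x} − 1)(a + sinh a − x) ≤ (cosh a − 1)(e^{x} + 1)` — the
difference decreases on `[0, a]` (there `e^{x}(x − a + e^{−a}) < 1`), increases on `[a, ∞)` (there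
`e^{x}(x − a + e^{−a}) ≥ 1`), and vanishes at `x = a`. [ours] -/
theorem sharpCert_nonneg (a : ℝ) {x : ℝ} (hx : 0 ≤ x) :
    (Real.exp x - 1) * (a + Real.sinh a - x) ≤ (Real.cosh a - 1) * (Real.exp x + 1) := by
  set F : ℝ → ℝ := fun x => (Real.cosh a - 1) * (Real.exp x + 1) - (Real.exp x - 1) * (a + Real.sinh a - x)
    with hF
  have hFc : Continuous F := by rw [hF]; fun_prop
  have hFa : F a = 0 := sharpCert_self a
  -- increasing on `[a, ∞)`
  have hmono : MonotoneOn F (Ici a) := by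
    refine monotoneOn_of_hasDerivWithinAt_nonneg (convex_Ici a) hFc.continuousOn
      (fun y _ => (hasDerivAt_sharpCert a y).hasDerivWithinAt) ?_
    intro y hy
    rw [interior_Ici] at hy
    have hy' : a < y := hy
    have h1 : Real.exp a ≤ Real.exp y := Real.exp_le_exp.mpr hy'.le
    have h2 : Real.exp (-a) ≤ y - a + Real.exp (-a) := by linarith
    have h3 : Real.exp a * Real.exp (-a) ≤ Real.exp y * (y - a + Real.exp (-a)) :=
      mul_le_mul h1 h2 (Real.exp_pos _).le (Real.exp_pos _).le
    have hea : Real.exp a * Real.exp (-a) = 1 := by rw [← Real.exp_add, add_neg_cancel, Real.exp_zero]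
    linarith
  -- decreasing on `[0, a]`
  have hanti : AntitoneOn F (Icc 0 a) := by
    refine antitoneOn_of_hasDerivWithinAt_nonpos (convex_Icc 0 a) hFc.continuousOn
      (fun y _ => (hasDerivAt_sharpCert a y).hasDerivWithinAt) ?_
    intro y hy
    rw [interior_Icc] at hy
    obtain ⟨_, hya⟩ := hy
    by_cases hs : y - a + Real.exp (-a) ≤ 0
    · have h1 : Real.exp y * (y - a + Real.exp (-a)) ≤ 0 :=
        mul_nonpos_of_nonneg_of_nonpos (Real.exp_pos _).le hs
      linarith
    · rw [not_le] at hs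
      have h1 : Real.exp y < Real.exp a := Real.exp_lt_exp.mpr hya
      have h2 : y - a + Real.exp (-a) ≤ Real.exp (-a) := by linarith
      have h3 : Real.exp y * (y - a + Real.exp (-a)) < Real.exp a * Real.exp (-a) :=
        mul_lt_mul h1 h2 hs (Real.exp_pos _).le
      have hea : Real.exp a * Real.exp (-a) = 1 := by rw [← Real.exp_add, add_neg_cancel, Real.exp_zero]
      linarith
  have key : 0 ≤ F x := by
    rcases le_or_gt x a with hxa | hxa
    · have h := hanti ⟨hx, hxa⟩ ⟨le_trans hx hxa, le_rfl⟩ hxa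
      rw [hFa] at h
      exact h
    · have h := hmono (self_mem_Ici (a := a)) (mem_Ici.mpr hxa.le) hxa.le
      rw [hFa] at h
      exact h
  have e : F x = (Real.cosh a - 1) * (Real.exp x + 1) - (Real.exp x - 1) * (a + Real.sinh a - x) := rfl
  linarith [key, e]

/-- **THE INTEGRAND FORM OF THE CERTIFICATE**: for every real `d` and every `a`,
`(1 − min(1, e^{−d}))·(a + sinh a) ≤ (cosh a − 1)·(1 + e^{−d})𝟙[d>0] + d(1 − e^{−d})𝟙[d>0]`
(both sides vanish for `d ≤ 0`; for `d > 0` it is the certificate at `x = d` times `e^{−d}`). [ours] -/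
theorem one_sub_min_exp_neg_mul_le (a d : ℝ) :
    (1 - min 1 (Real.exp (-d))) * (a + Real.sinh a)
      ≤ (Real.cosh a - 1) * ((1 + Real.exp (-d)) * (if 0 < d then (1 : ℝ) else 0))
        + d * (1 - Real.exp (-d)) * (if 0 < d then (1 : ℝ) else 0) := by
  by_cases hd : 0 < d
  · have h1 : Real.exp (-d) ≤ 1 := by
      rw [← Real.exp_zero]; exact Real.exp_le_exp.mpr (by linarith)
    rw [min_eq_right h1, if_pos hd, mul_one, mul_one]
    have hc : 0 ≤ (Real.cosh a - 1) * (Real.exp d + 1) - (Real.exp d - 1) * (a + Real.sinh a - d) :=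
      sub_nonneg.mpr (sharpCert_nonneg a hd.le)
    have hed : Real.exp d * Real.exp (-d) = 1 := by rw [← Real.exp_add, add_neg_cancel, Real.exp_zero]
    have hpos : 0 < Real.exp (-d) := Real.exp_pos _
    -- multiply the certificate by `e^{−d} > 0`
    have h2 : 0 ≤ ((Real.cosh a - 1) * (Real.exp d + 1) - (Real.exp d - 1) * (a + Real.sinh a - d))
        * Real.exp (-d) := mul_nonneg hc hpos.le
    have key : (Real.cosh a - 1) * (1 + Real.exp (-d)) + d * (1 - Real.exp (-d))
        - (1 - Real.exp (-d)) * (a + Real.sinh a)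
        = ((Real.cosh a - 1) * (Real.exp d + 1) - (Real.exp d - 1) * (a + Real.sinh a - d))
          * Real.exp (-d) := by
      linear_combination ((a + Real.sinh a) - d - (Real.cosh a - 1)) * hed
    linarith [h2, key]
  · have h1 : 1 ≤ Real.exp (-d) := by
      rw [← Real.exp_zero]; exact Real.exp_le_exp.mpr (by linarith)
    rw [min_eq_left h1, if_neg hd]
    simp

end Certificate

/-! ## §2 Volume-preserving involutions: the extremal acceptance floor -/

section Involutive

variable {X : Type*} [MeasurableSpace X] {μ : Measure X}

/-- **`∫ (1 + e^{−ΔH})𝟙[ΔH > 0] e^{−H} ≤ Z`**: by the fluctuation relation (`g = 𝟙[· < 0]`) the left side is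
`∫ 𝟙[ΔH > 0] e^{−H} + ∫ 𝟙[ΔH < 0] e^{−H}`. [ours] -/
theorem integral_posPart_weights_le {H : X → ℝ} {Ψ : X → X} (hH : Measurable H) (hΨm : Measurable Ψ)
    (hΨi : Function.Involutive Ψ) (hΨμ : MeasurePreserving Ψ μ μ)
    (hw : Integrable (fun z => Real.exp (-H z)) μ) :
    ∫ z, (1 + Real.exp (-deltaH H Ψ z)) * (if 0 < deltaH H Ψ z then (1 : ℝ) else 0) * Real.exp (-H z) ∂μ
      ≤ ∫ z, Real.exp (-H z) ∂μ := by
  have hΔm : Measurable (deltaH H Ψ) := measurable_deltaH hH hΨm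
  have hwm : Measurable fun z => Real.exp (-H z) := Real.measurable_exp.comp hH.neg
  have hw0 : ∀ z, 0 ≤ Real.exp (-H z) := fun z => (Real.exp_pos _).le
  have hpos_m : Measurable fun z => (if 0 < deltaH H Ψ z then (1 : ℝ) else 0) :=
    Measurable.ite (measurableSet_lt measurable_const hΔm) measurable_const measurable_const
  have hneg_m : Measurable fun z => if deltaH H Ψ z < 0 then (1 : ℝ) else 0 :=
    Measurable.ite (measurableSet_lt hΔm measurable_const) measurable_const measurable_const
  -- the two pieces
  have hI1 : Integrable (fun z => (if 0 < deltaH H Ψ z then (1 : ℝ) else 0) * Real.exp (-H z)) μ := by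
    refine integrable_bdd_mul_weight hpos_m (C := 1) (fun z => ?_) hwm hw0 hw
    split_ifs <;> simp
  have hI2 : Integrable (fun z => (if 0 < deltaH H Ψ z then (1 : ℝ) else 0) * Real.exp (-deltaH H Ψ z) * Real.exp (-H z)) μ := by
    refine integrable_bdd_mul_weight (hpos_m.mul (Real.measurable_exp.comp hΔm.neg)) (C := 1)
      (fun z => ?_) hwm hw0 hw
    split_ifs with h
    · have h1 : Real.exp (-deltaH H Ψ z) ≤ 1 := by
        rw [← Real.exp_zero]; exact Real.exp_le_exp.mpr (by linarith)
      rw [one_mul, abs_of_pos (Real.exp_pos _)]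
      exact h1
    · simp
  have hI3 : Integrable (fun z => (if deltaH H Ψ z < 0 then (1 : ℝ) else 0) * Real.exp (-H z)) μ := by
    refine integrable_bdd_mul_weight hneg_m (C := 1) (fun z => ?_) hwm hw0 hw
    split_ifs <;> simp
  -- the fluctuation relation turns `𝟙[ΔH > 0] e^{−ΔH}` into `𝟙[ΔH < 0]`
  have hrel := integral_comp_deltaH_eq (H := H) hΨm hΨi hΨμ (fun x => if x < 0 then (1 : ℝ) else 0)
  have hrel' : ∫ z, (if 0 < deltaH H Ψ z then (1 : ℝ) else 0) * Real.exp (-deltaH H Ψ z) * Real.exp (-H z) ∂μ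
      = ∫ z, (if deltaH H Ψ z < 0 then (1 : ℝ) else 0) * Real.exp (-H z) ∂μ := by
    rw [hrel]
    refine integral_congr_ae (Eventually.of_forall fun z => ?_)
    simp only [neg_lt_zero]
  have hsplit : ∀ z, (1 + Real.exp (-deltaH H Ψ z)) * (if 0 < deltaH H Ψ z then (1 : ℝ) else 0) * Real.exp (-H z)
      = (if 0 < deltaH H Ψ z then (1 : ℝ) else 0) * Real.exp (-H z)
        + (if 0 < deltaH H Ψ z then (1 : ℝ) else 0) * Real.exp (-deltaH H Ψ z) * Real.exp (-H z) := fun z => by ring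
  simp_rw [hsplit]
  rw [integral_add hI1 hI2, hrel', ← integral_add hI1 hI3]
  refine integral_mono (hI1.add hI3) hw fun z => ?_
  dsimp only
  by_cases h : 0 < deltaH H Ψ z
  · rw [if_pos h, if_neg (not_lt.mpr h.le)]
    simp
  · rw [if_neg h]
    split_ifs
    · simp
    · simp [hw0 z]

/-- **`∫ ΔH(1 − e^{−ΔH})𝟙[ΔH > 0] e^{−H} = ∫ ΔH e^{−H}`**: by the fluctuation relation (`g(x) = x𝟙[x < 0]`)
`∫ ΔH 𝟙[ΔH < 0] e^{−H} = −∫ ΔH e^{−ΔH} 𝟙[ΔH > 0] e^{−H}`. [ours] -/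
theorem integral_posPart_moment_eq {H : X → ℝ} {Ψ : X → X} (hH : Measurable H) (hΨm : Measurable Ψ)
    (hΨi : Function.Involutive Ψ) (hΨμ : MeasurePreserving Ψ μ μ)
    (hΔ : Integrable (fun z => deltaH H Ψ z * Real.exp (-H z)) μ) :
    ∫ z, deltaH H Ψ z * (1 - Real.exp (-deltaH H Ψ z)) * (if 0 < deltaH H Ψ z then (1 : ℝ) else 0) * Real.exp (-H z) ∂μ
      = ∫ z, deltaH H Ψ z * Real.exp (-H z) ∂μ := by
  have hΔm : Measurable (deltaH H Ψ) := measurable_deltaH hH hΨm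
  have hwm : Measurable fun z => Real.exp (-H z) := Real.measurable_exp.comp hH.neg
  have hw0 : ∀ z, 0 ≤ Real.exp (-H z) := fun z => (Real.exp_pos _).le
  have hpos_m : Measurable fun z => (if 0 < deltaH H Ψ z then (1 : ℝ) else 0) :=
    Measurable.ite (measurableSet_lt measurable_const hΔm) measurable_const measurable_const
  have hneg_m : Measurable fun z => if deltaH H Ψ z < 0 then (1 : ℝ) else 0 :=
    Measurable.ite (measurableSet_lt hΔm measurable_const) measurable_const measurable_const
  -- domination of the pieces by `|ΔH| e^{−H}`
  have hdom : ∀ (φ : X → ℝ), Measurable φ → (∀ z, |φ z| ≤ 1) →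
      Integrable (fun z => deltaH H Ψ z * φ z * Real.exp (-H z)) μ := by
    intro φ hφm hφb
    refine Integrable.mono' hΔ.norm ((hΔm.mul hφm).mul hwm).aestronglyMeasurable
      (Eventually.of_forall fun z => ?_)
    rw [Real.norm_eq_abs, Real.norm_eq_abs, abs_mul, abs_mul, abs_mul, abs_of_nonneg (hw0 z)]
    calc |deltaH H Ψ z| * |φ z| * Real.exp (-H z)
        ≤ |deltaH H Ψ z| * 1 * Real.exp (-H z) :=
          mul_le_mul_of_nonneg_right (mul_le_mul_of_nonneg_left (hφb z) (abs_nonneg _)) (hw0 z)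
      _ = |deltaH H Ψ z| * Real.exp (-H z) := by ring
  have hI1 : Integrable (fun z => deltaH H Ψ z * (if 0 < deltaH H Ψ z then (1 : ℝ) else 0) * Real.exp (-H z)) μ := by
    refine hdom _ hpos_m fun z => ?_
    split_ifs <;> simp
  have hI2 : Integrable (fun z => deltaH H Ψ z * ((if 0 < deltaH H Ψ z then (1 : ℝ) else 0) * Real.exp (-deltaH H Ψ z))
      * Real.exp (-H z)) μ := by
    refine hdom _ (hpos_m.mul (Real.measurable_exp.comp hΔm.neg)) fun z => ?_
    split_ifs with h
    · have h1 : Real.exp (-deltaH H Ψ z) ≤ 1 := by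
        rw [← Real.exp_zero]; exact Real.exp_le_exp.mpr (by linarith)
      rw [one_mul, abs_of_pos (Real.exp_pos _)]
      exact h1
    · simp
  have hI3 : Integrable (fun z => deltaH H Ψ z * (if deltaH H Ψ z < 0 then (1 : ℝ) else 0)
      * Real.exp (-H z)) μ := by
    refine hdom _ hneg_m fun z => ?_
    split_ifs <;> simp
  -- the fluctuation relation with `g(x) = x 𝟙[x < 0]`
  have hrel := integral_comp_deltaH_eq (H := H) hΨm hΨi hΨμ
    (fun x => x * (if x < 0 then (1 : ℝ) else 0))
  have hrel' : ∫ z, deltaH H Ψ z * (if deltaH H Ψ z < 0 then (1 : ℝ) else 0) * Real.exp (-H z) ∂μ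
      = -∫ z, deltaH H Ψ z * ((if 0 < deltaH H Ψ z then (1 : ℝ) else 0) * Real.exp (-deltaH H Ψ z)) * Real.exp (-H z) ∂μ := by
    rw [hrel, ← integral_neg]
    refine integral_congr_ae (Eventually.of_forall fun z => ?_)
    simp only [neg_lt_zero]
    ring
  have hsplit : ∀ z, deltaH H Ψ z * (1 - Real.exp (-deltaH H Ψ z)) * (if 0 < deltaH H Ψ z then (1 : ℝ) else 0) * Real.exp (-H z)
      = deltaH H Ψ z * (if 0 < deltaH H Ψ z then (1 : ℝ) else 0) * Real.exp (-H z)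
        - deltaH H Ψ z * ((if 0 < deltaH H Ψ z then (1 : ℝ) else 0) * Real.exp (-deltaH H Ψ z)) * Real.exp (-H z) :=
    fun z => by ring
  simp_rw [hsplit]
  rw [integral_sub hI1 hI2, sub_eq_add_neg, ← hrel', ← integral_add hI1 hI3]
  refine integral_congr_ae (Eventually.of_forall fun z => ?_)
  dsimp only
  by_cases h : 0 < deltaH H Ψ z
  · rw [if_pos h, if_neg (not_lt.mpr h.le)]
    ring
  · rw [if_neg h]
    by_cases h' : deltaH H Ψ z < 0
    · rw [if_pos h']
      ring
    · have h0 : deltaH H Ψ z = 0 := le_antisymm (not_lt.mp h) (not_lt.mp h')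
      rw [if_neg h', h0]
      ring

/-- **THE EXTREMAL ACCEPTANCE FLOOR OF A VOLUME-PRESERVING REVERSIBLE PROPOSAL.**  `Ψ` a measurable
`μ`-preserving involution, `e^{−H} ∈ L¹` with `Z = ∫ e^{−H} > 0`, `ΔH e^{−H} ∈ L¹`,
`⟨ΔH⟩ = Z⁻¹ ∫ ΔH e^{−H}`.  For EVERY `a > 0`:
`(1 − (cosh a − 1 + ⟨ΔH⟩)/(a + sinh a)) · Z ≤ ∫ min(1, e^{−ΔH}) e^{−H} dμ`.
The pencil is tangent to its envelope `1 − tanh(a/2)` at `⟨ΔH⟩ = a tanh(a/2)`, where the two-state flip of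
gap `a` attains it. [ours] -/
theorem involutive_acceptance_ge_cosh {H : X → ℝ} {Ψ : X → X} (hH : Measurable H)
    (hΨm : Measurable Ψ) (hΨi : Function.Involutive Ψ) (hΨμ : MeasurePreserving Ψ μ μ)
    (hw : Integrable (fun z => Real.exp (-H z)) μ)
    (hΔ : Integrable (fun z => deltaH H Ψ z * Real.exp (-H z)) μ) (hZ : 0 < ∫ z, Real.exp (-H z) ∂μ)
    {a : ℝ} (ha : 0 < a) :
    (1 - (Real.cosh a - 1 + (∫ z, deltaH H Ψ z * Real.exp (-H z) ∂μ) / ∫ z, Real.exp (-H z) ∂μ)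
        / (a + Real.sinh a)) * ∫ z, Real.exp (-H z) ∂μ
      ≤ ∫ z, min 1 (Real.exp (-deltaH H Ψ z)) * Real.exp (-H z) ∂μ := by
  set Z := ∫ z, Real.exp (-H z) ∂μ with hZdef
  set M := ∫ z, deltaH H Ψ z * Real.exp (-H z) ∂μ with hMdef
  set A := ∫ z, min 1 (Real.exp (-deltaH H Ψ z)) * Real.exp (-H z) ∂μ with hAdef
  have hΔm : Measurable (deltaH H Ψ) := measurable_deltaH hH hΨm
  have hwm : Measurable fun z => Real.exp (-H z) := Real.measurable_exp.comp hH.neg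
  have hw0 : ∀ z, 0 ≤ Real.exp (-H z) := fun z => (Real.exp_pos _).le
  have hc : 0 < a + Real.sinh a := add_pos ha (Real.sinh_pos_iff.mpr ha)
  have hκ : 0 ≤ Real.cosh a - 1 := sub_nonneg.mpr (Real.one_le_cosh a)
  have hpos_m : Measurable fun z => (if 0 < deltaH H Ψ z then (1 : ℝ) else 0) :=
    Measurable.ite (measurableSet_lt measurable_const hΔm) measurable_const measurable_const
  -- integrability of the three integrands
  have hIA : Integrable (fun z => min 1 (Real.exp (-deltaH H Ψ z)) * Real.exp (-H z)) μ := by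
    refine integrable_bdd_mul_weight (measurable_const.min (Real.measurable_exp.comp hΔm.neg)) (C := 1)
      (fun z => ?_) hwm hw0 hw
    rw [abs_of_pos (lt_min one_pos (Real.exp_pos _))]
    exact min_le_left _ _
  have hIG : Integrable (fun z => (1 + Real.exp (-deltaH H Ψ z)) * (if 0 < deltaH H Ψ z then (1 : ℝ) else 0)
      * Real.exp (-H z)) μ := by
    refine integrable_bdd_mul_weight (((measurable_const.add (Real.measurable_exp.comp hΔm.neg))).mul
      hpos_m) (C := 2) (fun z => ?_) hwm hw0 hw
    split_ifs with h
    · have h1 : Real.exp (-deltaH H Ψ z) ≤ 1 := by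
        rw [← Real.exp_zero]; exact Real.exp_le_exp.mpr (by linarith)
      rw [mul_one, abs_of_pos (by positivity)]
      linarith
    · simp
  have hIK : Integrable (fun z => deltaH H Ψ z * (1 - Real.exp (-deltaH H Ψ z)) * (if 0 < deltaH H Ψ z then (1 : ℝ) else 0)
      * Real.exp (-H z)) μ := by
    refine Integrable.mono' hΔ.norm
      ((((hΔm.mul (measurable_const.sub (Real.measurable_exp.comp hΔm.neg))).mul hpos_m).mul
        hwm).aestronglyMeasurable) (Eventually.of_forall fun z => ?_)
    · rw [Real.norm_eq_abs, Real.norm_eq_abs, abs_mul, abs_mul, abs_mul, abs_mul, abs_of_nonneg (hw0 z)]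
      have hb : |1 - Real.exp (-deltaH H Ψ z)| * |(if 0 < deltaH H Ψ z then (1 : ℝ) else 0)| ≤ 1 := by
        split_ifs with h
        · have h1 : Real.exp (-deltaH H Ψ z) ≤ 1 := by
            rw [← Real.exp_zero]; exact Real.exp_le_exp.mpr (by linarith)
          rw [abs_one, mul_one, abs_of_nonneg (by linarith)]
          linarith [Real.exp_pos (-deltaH H Ψ z)]
        · simp
      calc |deltaH H Ψ z| * |1 - Real.exp (-deltaH H Ψ z)| * |(if 0 < deltaH H Ψ z then (1 : ℝ) else 0)| * Real.exp (-H z)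
          = |deltaH H Ψ z| * (|1 - Real.exp (-deltaH H Ψ z)| * |(if 0 < deltaH H Ψ z then (1 : ℝ) else 0)|)
              * Real.exp (-H z) := by ring
        _ ≤ |deltaH H Ψ z| * 1 * Real.exp (-H z) :=
            mul_le_mul_of_nonneg_right (mul_le_mul_of_nonneg_left hb (abs_nonneg _)) (hw0 z)
        _ = |deltaH H Ψ z| * Real.exp (-H z) := by ring
  -- integrate the certificate
  have hpt : ∀ z, (a + Real.sinh a) * (Real.exp (-H z) - min 1 (Real.exp (-deltaH H Ψ z)) * Real.exp (-H z))
      ≤ (Real.cosh a - 1) * ((1 + Real.exp (-deltaH H Ψ z)) * (if 0 < deltaH H Ψ z then (1 : ℝ) else 0) * Real.exp (-H z))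
        + deltaH H Ψ z * (1 - Real.exp (-deltaH H Ψ z)) * (if 0 < deltaH H Ψ z then (1 : ℝ) else 0) * Real.exp (-H z) := by
    intro z
    have h := mul_le_mul_of_nonneg_right (one_sub_min_exp_neg_mul_le a (deltaH H Ψ z)) (hw0 z)
    nlinarith [h]
  have hJ1 : Integrable (fun z => (a + Real.sinh a)
      * (Real.exp (-H z) - min 1 (Real.exp (-deltaH H Ψ z)) * Real.exp (-H z))) μ :=
    (hw.sub hIA).const_mul (a + Real.sinh a)
  have hJ2 : Integrable (fun z =>
      (Real.cosh a - 1) * ((1 + Real.exp (-deltaH H Ψ z)) * (if 0 < deltaH H Ψ z then (1 : ℝ) else 0) * Real.exp (-H z))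
        + deltaH H Ψ z * (1 - Real.exp (-deltaH H Ψ z)) * (if 0 < deltaH H Ψ z then (1 : ℝ) else 0) * Real.exp (-H z)) μ :=
    (hIG.const_mul (Real.cosh a - 1)).add hIK
  have hmono := integral_mono hJ1 hJ2 hpt
  rw [integral_const_mul, integral_sub hw hIA, integral_add (hIG.const_mul _) hIK, integral_const_mul,
    integral_posPart_moment_eq hH hΨm hΨi hΨμ hΔ] at hmono
  have hG := integral_posPart_weights_le hH hΨm hΨi hΨμ hw
  -- `(a + sinh a)(Z − A) ≤ (cosh a − 1)·Z + M`
  have key : (a + Real.sinh a) * (Z - A) ≤ (Real.cosh a - 1) * Z + M := by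
    have h2 := mul_le_mul_of_nonneg_left hG hκ
    linarith
  have e : (1 - (Real.cosh a - 1 + M / Z) / (a + Real.sinh a)) * Z
      = Z - ((Real.cosh a - 1) * Z + M) / (a + Real.sinh a) := by
    field_simp
  rw [e, sub_le_comm, le_div_iff₀ hc, mul_comm]
  exact key

end Involutive

end Summit.Ventures.LatticeQCDFlow.Exactness
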